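import Summits.CriticalPhenomena.CardyFormulaZ2.Theorems.CardySegmentWeakRSWClosedOfWeakBoxCrossingSpecialises
import Summits.CriticalPhenomena.CardyFormulaZ2.Theorems.CardySegmentWeakRSWClosedOfWeakBoxCrossingOnPath
import HarnessLib

/-!
# Route `CardySegmentWeakRSW`, rung `ClosedOfWeakBoxCrossing` (stmt-CriticalPhenomena-18421):
  kernel-visible F3 witness and the on-path certificate in `↔` form

Forward discipline, generation 3 of the on-path lander for this rung (floor
`Theorems.segmentClosed_proof : CardySelfDualSegment.SegmentClosed`).

* F3 (`specialises`). The dial theorem `segmentClosed_of_closedOfWeakBoxCrossing : rung → floor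
  statement` (landed, `…Specialises.lean`) is made an `aesop` FORWARD rule, so the forward kernel's
  `Rung → Ftype` portfolio (`intro h; aesop`, no library search) READS it: a special example the
  kernel cannot reach counts as `specialises = false` (TRIBUNAL-FIT F3). A forward rule fires only when
  a hypothesis of type `ClosedOfWeakBoxCrossing` is in context; it cannot close `floor → rung` or the
  rung outright (`real_step` unaffected) and adds only the PROVED statement `SegmentClosed` elsewhere.
  `closedOfWeakBoxCrossing_iff_segmentClosed_of_uniformBoxCrossing`: at the floor's own dial position
  (`UniformBoxCrossing`) the rung IS the floor statement.
* F4 (`on_path`). Not achievable for this rung and NOT attempted: `CardyFormulaZ2` speaks of the single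
  model `M_1` (bond percolation on `ℤ²`), the rung of every corner model `M_t`, `t ∈ [0,1]`.
  `cardy_imp_closedOfWeakBoxCrossing_iff_cardy_imp_target` records exactly what an on-path lemma would
  be: modulo the route's three sibling cruxes (hypotheses, not asserted) a proof of
  `CardyFormulaZ2 → ClosedOfWeakBoxCrossing` is the same thing as a proof of
  `CardyFormulaZ2 → CardySelfDualSegment.Target` (Cardy for bond-`ℤ²` propagating to linear
  universality along the whole self-dual corner segment, stmt-CriticalPhenomena-5470), whose converse
  `Target → CardyFormulaZ2` is the landed `cardyFormulaZ2_of_target`.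

No statement of either route is asserted unconditionally. [folklore]

prover-fwd2-land-1-g3-0 (on-path lander, gen 3), 2026-08-18.
-/

namespace Summit.CriticalPhenomena.CardyFormulaZ2.Theorems

/-! ## F3: the dial witness as a kernel-readable rule -/

attribute [aesop safe forward] segmentClosed_of_closedOfWeakBoxCrossing

/-- **At the floor's dial position the rung is the floor.** Under `UniformBoxCrossing` (the floor's
own first hypothesis, stmt-CriticalPhenomena-5476, taken as a hypothesis) the rung
`ClosedOfWeakBoxCrossing` and the floor statement `SegmentClosed` are equivalent: `→` is the dial
(`segmentClosed_of_closedOfWeakBoxCrossing`, valid without the hypothesis), `←` discards the rung's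
weak-box-crossing hypothesis and feeds `UniformBoxCrossing` to the floor statement. [folklore] -/
theorem closedOfWeakBoxCrossing_iff_segmentClosed_of_uniformBoxCrossing
    (hU : Theses.CardySelfDualSegment.UniformBoxCrossing) :
    Theses.CardySegmentWeakRSW.ClosedOfWeakBoxCrossing ↔ Theses.CardySelfDualSegment.SegmentClosed :=
  ⟨segmentClosed_of_closedOfWeakBoxCrossing, fun hS _ hM => hS hU hM⟩

/-- The forward kernel's literal `Rung → Ftype` goal, closed by its literal tactic through the forward
rule above (what `forward.specialises` measures). [folklore] -/
example : Theses.CardySegmentWeakRSW.ClosedOfWeakBoxCrossing →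
    Theses.CardySelfDualSegment.SegmentClosed := by
  intro h; aesop

/-! ## F4: what an on-path lemma for this rung would be -/

/-- **On-path certificate.** Modulo the sibling cruxes `WeakBoxCrossing`, `SegmentOpen`,
`UniformMarginality` of route `CardySegmentWeakRSW` (hypotheses, none asserted), an on-path lemma
`CardyFormulaZ2 → ClosedOfWeakBoxCrossing` is EQUIVALENT to `CardyFormulaZ2 → CardySelfDualSegment.Target`
(Cardy's formula for `P_{1/2}` bond percolation on `ℤ²` implies Cardy-mod-shear for every corner model
`M_t`): by `closedOfWeakBoxCrossing_iff_target`. Since `Target → CardyFormulaZ2` is landed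
(`cardyFormulaZ2_of_target`), such a lemma would make the summit conjunct and segment universality
equivalent given the siblings — it is not a cheap step, which is why the forward kernel reads
`on_path = false` for this birth structurally. [folklore] -/
theorem cardy_imp_closedOfWeakBoxCrossing_iff_cardy_imp_target
    (hW : Theses.CardySegmentWeakRSW.WeakBoxCrossing) (hO : Theses.CardySegmentWeakRSW.SegmentOpen)
    (hM : Theses.CardySegmentWeakRSW.UniformMarginality) :
    (_root_.CardyFormulaZ2 → Theses.CardySegmentWeakRSW.ClosedOfWeakBoxCrossing) ↔
      (_root_.CardyFormulaZ2 → Theses.CardySelfDualSegment.Target) :=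
  ⟨fun h hs => (closedOfWeakBoxCrossing_iff_target hW hO hM).1 (h hs),
    fun h hs => closedOfWeakBoxCrossing_of_target (h hs)⟩

/-- **Given the siblings, an on-path lemma would identify summit and segment universality.**
[folklore] -/
theorem cardy_iff_target_of_onPath
    (hW : Theses.CardySegmentWeakRSW.WeakBoxCrossing) (hO : Theses.CardySegmentWeakRSW.SegmentOpen)
    (hM : Theses.CardySegmentWeakRSW.UniformMarginality)
    (honPath : _root_.CardyFormulaZ2 → Theses.CardySegmentWeakRSW.ClosedOfWeakBoxCrossing) :
    _root_.CardyFormulaZ2 ↔ Theses.CardySelfDualSegment.Target :=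
  ⟨(cardy_imp_closedOfWeakBoxCrossing_iff_cardy_imp_target hW hO hM).1 honPath,
    cardyFormulaZ2_of_target⟩

-- `real_step` guard: the forward rule must not close `floor → rung` (it needs the rung in context).
example (h : Theses.CardySelfDualSegment.SegmentClosed) :
    Theses.CardySelfDualSegment.SegmentClosed := by
  fail_if_success
    (exact (by aesop (config := { terminal := true }) :
      Theses.CardySegmentWeakRSW.ClosedOfWeakBoxCrossing))
  exact h

end Summit.CriticalPhenomena.CardyFormulaZ2.Theorems
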